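import Literature.NumberTheory.GaloisCohomology.Howard2004.RingClassConjugationStableProofs
import Literature.NumberTheory.EllipticCurves.RingClassFieldConjugation
import HarnessLib

/-!
# The DIHEDRAL letter of a conjugation datum: `φ_q(g) · g ∈ Γ_{K_q} ∩ Γ_{K[c]}` at an inert prime,
# for EVERY `ConjugationDatum` (proofs file)

Topic `NumberTheory/GaloisCohomology/Howard2004` (sequel to `RingClassConjugationStableProofs`).
THEOREMS ONLY: no definition, no named fact, no instance, no notation, no `sorry`.

B. Howard, *The Heegner point Kolyvagin system*, Compositio Math. **140** (2004) = arXiv:1202.6340, §1.3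
(p. 7 L33–48): the local transports `φ_v : Γ_{K_v} → Γ_{K_v̄}` of «conjugation by `τ`», and Lemma 1.5.3
(proof, p. 10 L12–16) where, at a degree-two prime `λ`, the local complex conjugation acts on
`H¹_s(K_λ, T̄) ⊗ k^× ≅ T̄` — i.e. it INVERTS `Gal(K[ℓ]_λ/K_λ)` because `K[ℓ]/ℚ` is generalised dihedral
(Cox, Lemma 9.3: «the nontrivial element of `ℤ/2ℤ` acts on `Gal(L/K)` by sending `σ` to its inverse»).
In the tree this is the LETTER `hdih : φ'_q(σ₀) · σ₀ ∈ Λ_q` of `InertEigenlinesProofs` and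
`hφΛ : ∀ k, ∃ l ∈ Λ_q, φ'_q k = l · k⁻¹` of `InertLocalPairingSymmetricProofs` /
`InertLagrangianTransferProofs` / `InertStubLocalizationTransferProofs` /
`FrobeniusReadoutLagrangianTransferProofs` (`Λ_q = localRingClassSubgroup ℓ jbar q = Γ_{K_q} ∩ Γ_{K[ℓ]}`,
`φ'_q = (σ q = q) ▸ φ_q`).  This file DISCHARGES that letter for EVERY `cd : ConjugationDatum K`
(`K` imaginary quadratic, `c ≠ 0`): no self-normalisation of decomposition groups is needed for it —
only the compatibility `res ∘ φ_q = δ_q⁻¹ (τ⁻¹ · τ) δ_q ∘ res` of the datum, the dihedral relation, and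
`Gal(K[c]/K)` abelian.

* §1 (namespace `Literature.NumberTheory.EllipticCurves`, the concrete `K[c] = ringClassField K ι c ⊂ ℂ`):
  an automorphism `ψ` of `ℂ` with `ψ ∘ ι = ι ∘ c` for some `c ∈ Aut_ℚ(K)` stabilises `K[c]`
  (`ringEquiv_apply_mem_ringClassField_iff_of_apply_eq_apply`) and restricts to an element of
  `Aut_ℚ(K[c])` (`exists_algEquiv_coe_eq_of_apply_eq_apply`), outside `𝒢_c` when `c ≠ 1`;
  **`IsLiftOfAut.conjGalCMH_mul_mem_ringClassSubgroup`** — for ANY lift `τ` to `K̄` of the non-trivial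
  automorphism `σ` of `K` and any `g ∈ Γ_K`: `(τ⁻¹ g τ) · g ∈ Γ_{K[c]} = ringClassSubgroup K c jbar`
  (Cox Lemma 9.3, dihedral half, read on `Γ_K` through `jbar : K̄ → ℂ`: the tree's
  `mul_mul_inv_eq_inv_of_not_mem_ringClassGal` for `K[c] ⊂ ℂ`); **`commutator_mem_ringClassSubgroup`**
  — `a b a⁻¹ b⁻¹ ∈ Γ_{K[c]}` (`Gal(K[c]/K)` abelian, the tree's `commute_of_mem_ringClassGal`).
* §2 (namespace `…Howard2004.ConjugationDatum`): `absGaloisRestrict_cast_eq` (restriction to `K̄`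
  commutes with the place cast `(σ q = q) ▸ ·`); **`conj_mul_mem_ringClassSubgroup`** (`cd.conj g · g ∈ Γ_{K[c]}`);
  **`φ_cast_mul_mem_localRingClassSubgroup`** — for `h : cd.σ • q = q` and every `g ∈ Γ_{K_q}`,
  `(h ▸ cd.φ q g) * g ∈ localRingClassSubgroup c jbar q` (= `hdih` at `g := σ₀`);
  **`exists_mem_localRingClassSubgroup_φ_cast_eq`** — the `hφΛ` shape `∃ l ∈ Λ_q, (h ▸ cd.φ q g) = l * g⁻¹`;
  `mul_φ_cast_mem_localRingClassSubgroup` (factors swapped); and the cast-free form at ANY finite place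
  `absGaloisRestrict_φ_mul_mem_ringClassSubgroup`: `res (cd.φ q g) * res g ∈ Γ_{K[c]}`.

Cell `pub/bsd-print-x9`, G87 = Howard 2004 Thm. 1.6.1 (print leaf `stub_h161` of stmt-BirchSwinnertonDyer-22642);
seat `bsd-line-x10b-p1-w5` g9, brick (DATUM-GEN) part 1 = (DIH-GEN).  NOT HERE: the letters (φI)/`hφγ`
(`φ_q` is the identity modulo inertia), (δ)/`hδ`, `hΘ` — those DO need the self-normalisation of
decomposition groups (NSW (12.1.3)) for a general datum; `thm161_dvrKolyvaginBound` is NOT proved; no summit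
statement is proved; BSD is not proved by any of this.

References: [Howard2004HeegnerKolyvagin] §1.3 (arXiv:1202.6340 p. 7 L33–48), Lemma 1.5.3 (p. 10 L12–16);
[Cox2013] §9.A Lemma 9.3 (pp. 181–182), §11.A Thm. 11.1; [GrossLMS1991] §5 (proof of Prop. 5.4: `τ σ τ⁻¹ = σ⁻¹`).
-/

set_option autoImplicit false

noncomputable section

open scoped Classical NumberField
open NumberField IsDedekindDomain Field

/-! ## §1 The dihedral relation read on `Γ_K` through `jbar : K̄ → ℂ` -/

namespace Literature.NumberTheory.EllipticCurves

variable {K : Type} [Field K] [NumberField K]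

/-- An automorphism `ψ` of `ℂ` with `ψ ∘ ι = ι ∘ c` for an automorphism `c` of `K` maps `K[n]` INTO `K[n]`
(`n ≠ 0`): `K[n]` is generated by `ι(K)` (mapped onto itself) and the singular moduli of discriminant
`n²d_K` (permuted by every automorphism of `ℂ`, Cox (10.26)). [cite: Cox2013, §9.A Lemma 9.3 and §11.A Thm. 11.1] -/
theorem map_ringClassField_le_of_apply_eq_apply (hK : IsImaginaryQuadratic K) (ι : K →+* ℂ)
    {n : ℕ} (hn : n ≠ 0) {ψ : ℂ ≃+* ℂ} (c : K ≃ₐ[ℚ] K) (hψ : ∀ k : K, ψ (ι k) = ι (c k)) :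
    (ringClassField K ι n).map ψ.toRingHom ≤ ringClassField K ι n := by
  unfold ringClassField
  rw [RingHom.map_field_closure]
  apply Subfield.closure_mono
  rintro _ ⟨x, hx, rfl⟩
  rcases hx with ⟨k, rfl⟩ | hx
  · exact Or.inl ⟨c k, (hψ k).symm⟩
  · exact Or.inr (ringEquiv_apply_mem_ringClassSingularModuli hK ψ hn hx)

/-- **An automorphism of `ℂ` restricting to an automorphism of `ι(K)` stabilises `K[n]`**: for `ψ` with
`ψ ∘ ι = ι ∘ c`, `ψ x ∈ K[n] ↔ x ∈ K[n]` (`n ≠ 0`) — «`K[n]/ℚ` is Galois» seen inside `ℂ`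
(the case `c = 1` is the tree's `ringEquiv_apply_mem_ringClassField_iff`).
[cite: Cox2013, §9.A Lemma 9.3 and §11.A Thm. 11.1] -/
theorem ringEquiv_apply_mem_ringClassField_iff_of_apply_eq_apply (hK : IsImaginaryQuadratic K)
    (ι : K →+* ℂ) {n : ℕ} (hn : n ≠ 0) {ψ : ℂ ≃+* ℂ} (c : K ≃ₐ[ℚ] K)
    (hψ : ∀ k : K, ψ (ι k) = ι (c k)) (x : ℂ) :
    ψ x ∈ ringClassField K ι n ↔ x ∈ ringClassField K ι n := by
  have hψ' : ∀ k : K, ψ.symm (ι k) = ι (c.symm k) := fun k => by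
    rw [RingEquiv.symm_apply_eq, hψ, AlgEquiv.apply_symm_apply]
  constructor
  · intro h
    have h' : ψ.symm (ψ x) ∈ ringClassField K ι n :=
      map_ringClassField_le_of_apply_eq_apply hK ι hn c.symm hψ' ⟨ψ x, h, rfl⟩
    rwa [RingEquiv.symm_apply_apply] at h'
  · intro h
    exact map_ringClassField_le_of_apply_eq_apply hK ι hn c hψ ⟨x, h, rfl⟩

/-- **Such an automorphism of `ℂ` restricts to an element of `Aut_ℚ(K[n])`**: some `t ∈ Aut_ℚ(K[n])` has
`↑(t x) = ψ x` for all `x ∈ K[n]` (an existence, no definition; the case `c = 1` is the tree's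
`Darmon2004.exists_mem_ringClassGal_coe_eq`). [cite: Cox2013, §9.A Lemma 9.3 and §11.A Thm. 11.1] -/
theorem exists_algEquiv_coe_eq_of_apply_eq_apply (hK : IsImaginaryQuadratic K) (ι : K →+* ℂ)
    {n : ℕ} (hn : n ≠ 0) {ψ : ℂ ≃+* ℂ} (c : K ≃ₐ[ℚ] K) (hψ : ∀ k : K, ψ (ι k) = ι (c k)) :
    ∃ t : ringClassField K ι n ≃ₐ[ℚ] ringClassField K ι n,
      ∀ x : ringClassField K ι n, ((t x : ringClassField K ι n) : ℂ) = ψ x := by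
  have hmem : ∀ x : ℂ, ψ x ∈ ringClassField K ι n ↔ x ∈ ringClassField K ι n :=
    ringEquiv_apply_mem_ringClassField_iff_of_apply_eq_apply hK ι hn c hψ
  let e : ringClassField K ι n ≃+* ringClassField K ι n :=
    { toFun := fun x ↦ ⟨ψ x, (hmem x).mpr x.2⟩
      invFun := fun x ↦ ⟨ψ.symm x, (hmem (ψ.symm x)).mp (by rw [ψ.apply_symm_apply]; exact x.2)⟩
      left_inv := fun x ↦ Subtype.ext (ψ.symm_apply_apply (x : ℂ))
      right_inv := fun x ↦ Subtype.ext (ψ.apply_symm_apply (x : ℂ))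
      map_mul' := fun x y ↦ Subtype.ext (map_mul ψ (x : ℂ) (y : ℂ))
      map_add' := fun x y ↦ Subtype.ext (map_add ψ (x : ℂ) (y : ℂ)) }
  have he : ∀ x : ringClassField K ι n, ((e x : ringClassField K ι n) : ℂ) = ψ x := fun _ ↦ rfl
  let t : ringClassField K ι n ≃ₐ[ℚ] ringClassField K ι n :=
    AlgEquiv.ofRingEquiv (f := e) fun q ↦ by
      apply Subtype.ext
      rw [he]
      simp only [eq_ratCast, SubfieldClass.coe_ratCast, map_ratCast]
  exact ⟨t, fun x ↦ by rw [AlgEquiv.ofRingEquiv_apply, he]⟩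

/-- The restriction of `ψ` to `K[n]` lies OUTSIDE `𝒢_n = Gal(K[n]/K)` as soon as `ψ` moves `ι(K)` (`c ≠ 1`).
[cite: Cox2013, §9.A Lemma 9.3] -/
theorem not_mem_ringClassGal_of_coe_eq_of_apply_eq_apply (ι : K →+* ℂ) {n : ℕ} {ψ : ℂ ≃+* ℂ}
    {c : K ≃ₐ[ℚ] K} (hc : c ≠ 1) (hψ : ∀ k : K, ψ (ι k) = ι (c k))
    {t : ringClassField K ι n ≃ₐ[ℚ] ringClassField K ι n}
    (ht : ∀ x : ringClassField K ι n, ((t x : ringClassField K ι n) : ℂ) = ψ x) :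
    t ∉ ringClassGal ι n := by
  intro hmem
  apply hc
  ext k
  have h := (mem_ringClassGal_iff_forall_apply_algebraMap ι n t).mp hmem k
  have h' := congrArg (fun z : ringClassField K ι n => (z : ℂ)) h
  simp only [ht, coe_algebraMap_ringClassField, hψ] at h'
  exact ι.injective h'

/-- **Cox's Lemma 9.3, dihedral half, read on `Γ_K = Gal(K̄/K)`**: for `K` imaginary quadratic, `σ ≠ 1` the
non-trivial automorphism of `K`, ANY ring automorphism `τ` of `K̄` lifting `σ`, `c ≠ 0` and any `g ∈ Γ_K`:
`(τ⁻¹ g τ) · g ∈ Γ_{K[c]} = ringClassSubgroup K c jbar` — i.e. `τ⁻¹ g τ ≡ g⁻¹` modulo `Gal(K̄/K[c])`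
(«`Gal(L/ℚ) ≃ Gal(L/K) ⋊ ℤ/2ℤ`, the nontrivial element acting by `σ ↦ σ⁻¹`»; Gross 1991 §5: `τ σ τ⁻¹ = σ⁻¹`).
Proof: read `τ` and `g` in `ℂ` along `jbar` (`exists_ringEquiv_apply_eq_ringEquiv_apply`,
`exists_ringEquiv_exists_mem_ringClassGal_of_absoluteGaloisGroup`), restrict to `K[c] ⊂ ℂ` (§1), apply the
tree's `mul_mul_inv_eq_inv_of_not_mem_ringClassGal`, and conclude with
`mem_ringClassSubgroup_of_ringEquiv_apply_eq_self`.
[cite: Cox2013, §9.A Lemma 9.3 (pp. 181–182) and §11.A Thm. 11.1] [cite: GrossLMS1991, §5 (proof of Prop. 5.4)] -/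
theorem IsLiftOfAut.conjGalCMH_mul_mem_ringClassSubgroup {σ : K ≃ₐ[ℚ] K} (hσ : σ ≠ 1)
    {τ : AlgebraicClosure K ≃+* AlgebraicClosure K} (hτ : IsLiftOfAut σ τ)
    (hK : IsImaginaryQuadratic K) (jbar : AlgebraicClosure K →+* ℂ) {c : ℕ} (hc : c ≠ 0)
    (g : Field.absoluteGaloisGroup K) :
    hτ.conjGalCMH g * g ∈ ringClassSubgroup K c jbar := by
  set ι : K →+* ℂ := jbar.comp (algebraMap K (AlgebraicClosure K)) with hι
  -- `τ` read in `ℂ` and restricted to `K[c]`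
  obtain ⟨θC, hθC⟩ := exists_ringEquiv_apply_eq_ringEquiv_apply jbar τ
  have hθK : ∀ k : K, θC (ι k) = ι (σ k) := fun k => by
    simp only [hι, RingHom.comp_apply]
    rw [hθC, hτ k]
  obtain ⟨t, ht⟩ := exists_algEquiv_coe_eq_of_apply_eq_apply hK ι hc σ hθK
  have htG : t ∉ ringClassGal ι c := not_mem_ringClassGal_of_coe_eq_of_apply_eq_apply ι hσ hθK ht
  -- `g` read in `ℂ` and restricted to `K[c]`
  obtain ⟨gC, hgC, gb, hgb, hgbx⟩ :=
    exists_ringEquiv_exists_mem_ringClassGal_of_absoluteGaloisGroup hK jbar hc g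
  -- the dihedral relation on `K[c]`: `gb ∘ t ∘ gb = t`
  have hdih : t * gb * t⁻¹ = gb⁻¹ := mul_mul_inv_eq_inv_of_not_mem_ringClassGal hK ι hc htG hgb
  have key : ∀ z : ringClassField K ι c, gb (t (gb z)) = t z := by
    intro z
    have h1 : t * gb = gb⁻¹ * t := by rw [← hdih]; group
    have h2 := AlgEquiv.congr_fun h1 z
    simp only [AlgEquiv.mul_apply] at h2
    rw [h2, ← AlgEquiv.mul_apply gb gb⁻¹, mul_inv_cancel, AlgEquiv.one_apply]
  -- the automorphism of `ℂ` inducing `(τ⁻¹ g τ) · g` along `jbar`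
  refine mem_ringClassSubgroup_of_ringEquiv_apply_eq_self
    (σC := gC.trans (θC.trans (gC.trans θC.symm))) (fun a => ?_) (fun x hx => ?_)
  · change θC.symm (gC (θC (gC (jbar a)))) = jbar ((hτ.conjGalCMH g * g) • a)
    rw [mul_smul, hgC, hθC, hgC, Field.absoluteGaloisGroup.smul_def (hτ.conjGalCMH g)]
    change θC.symm (jbar (g • τ (g • a))) =
      jbar (τ.symm ((Field.absoluteGaloisGroup.toAlgEquiv K g) (τ (g • a))))
    rw [RingEquiv.symm_apply_eq, hθC, RingEquiv.apply_symm_apply, Field.absoluteGaloisGroup.smul_def g]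
  · change θC.symm (gC (θC (gC x))) = x
    have e1 : gC x = ((gb ⟨x, hx⟩ : ringClassField K ι c) : ℂ) := (hgbx ⟨x, hx⟩).symm
    have e2 : θC ((gb ⟨x, hx⟩ : ringClassField K ι c) : ℂ) =
        ((t (gb ⟨x, hx⟩) : ringClassField K ι c) : ℂ) := (ht _).symm
    have e3 : gC ((t (gb ⟨x, hx⟩) : ringClassField K ι c) : ℂ) =
        ((gb (t (gb ⟨x, hx⟩)) : ringClassField K ι c) : ℂ) := (hgbx _).symm
    rw [e1, e2, e3, key, ht, RingEquiv.symm_apply_apply]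

/-- **`Gal(K[c]/K)` is abelian, read on `Γ_K`**: `a b a⁻¹ b⁻¹ ∈ Γ_{K[c]} = ringClassSubgroup K c jbar` for all
`a, b ∈ Γ_K` (`K` imaginary quadratic, `c ≠ 0`; the tree's `commute_of_mem_ringClassGal` for `K[c] ⊂ ℂ`,
transported along `jbar` as above). [cite: Cox2013, §9.A Lemma 9.3 and §11.A Thm. 11.1 (Gal(K[c]/K) ≅ Pic(𝒪_c))] -/
theorem commutator_mem_ringClassSubgroup (hK : IsImaginaryQuadratic K) (jbar : AlgebraicClosure K →+* ℂ)
    {c : ℕ} (hc : c ≠ 0) (a b : Field.absoluteGaloisGroup K) :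
    a * b * a⁻¹ * b⁻¹ ∈ ringClassSubgroup K c jbar := by
  set ι : K →+* ℂ := jbar.comp (algebraMap K (AlgebraicClosure K)) with hι
  obtain ⟨aC, haC, ab, hab, habx⟩ :=
    exists_ringEquiv_exists_mem_ringClassGal_of_absoluteGaloisGroup hK jbar hc a
  obtain ⟨bC, hbC, bb, hbb, hbbx⟩ :=
    exists_ringEquiv_exists_mem_ringClassGal_of_absoluteGaloisGroup hK jbar hc b
  have hcomm : ab * bb = bb * ab := commute_of_mem_ringClassGal hK hc hab hbb
  have haCsymm : ∀ x, aC.symm (jbar x) = jbar (a⁻¹ • x) := fun x => by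
    rw [RingEquiv.symm_apply_eq, haC, smul_inv_smul]
  have hbCsymm : ∀ x, bC.symm (jbar x) = jbar (b⁻¹ • x) := fun x => by
    rw [RingEquiv.symm_apply_eq, hbC, smul_inv_smul]
  -- restrictions of the inverses to `K[c]`
  have habs : ∀ z : ringClassField K ι c, aC.symm z = ((ab⁻¹ z : ringClassField K ι c) : ℂ) := fun z => by
    rw [RingEquiv.symm_apply_eq, ← habx, ← AlgEquiv.mul_apply, mul_inv_cancel, AlgEquiv.one_apply]
  have hbbs : ∀ z : ringClassField K ι c, bC.symm z = ((bb⁻¹ z : ringClassField K ι c) : ℂ) := fun z => by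
    rw [RingEquiv.symm_apply_eq, ← hbbx, ← AlgEquiv.mul_apply, mul_inv_cancel, AlgEquiv.one_apply]
  refine mem_ringClassSubgroup_of_ringEquiv_apply_eq_self
    (σC := bC.symm.trans (aC.symm.trans (bC.trans aC))) (fun x => ?_) (fun x hx => ?_)
  · change aC (bC (aC.symm (bC.symm (jbar x)))) = jbar ((a * b * a⁻¹ * b⁻¹) • x)
    rw [hbCsymm, haCsymm, hbC, haC, mul_smul, mul_smul, mul_smul]
  · change aC (bC (aC.symm (bC.symm x))) = x
    have e0 : x = ((⟨x, hx⟩ : ringClassField K ι c) : ℂ) := rfl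
    rw [e0, hbbs, habs, ← hbbx, ← habx, ← AlgEquiv.mul_apply, ← AlgEquiv.mul_apply, ← AlgEquiv.mul_apply,
      show ab * bb * ab⁻¹ * bb⁻¹ = 1 by rw [hcomm, mul_inv_cancel_right, mul_inv_cancel],
      AlgEquiv.one_apply]

end Literature.NumberTheory.EllipticCurves

/-! ## §2 The dihedral letter of a conjugation datum at an inert prime -/

namespace Literature.NumberTheory.GaloisCohomology.Howard2004

open Literature.NumberTheory.GaloisRepresentations
open Literature.NumberTheory.EllipticCurves

variable {K : Type} [Field K] [NumberField K]

/-- Restriction to `K̄` commutes with the transport of a local Galois element along an equality of places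
`e : v = w` (the cast `e ▸ ·` between `Γ_{K_v}` and `Γ_{K_w}`). [cite: Howard2004HeegnerKolyvagin, §1.3 (arXiv p. 7 L44–48, read at a degree-two prime `λ̄ = λ`)] -/
theorem absGaloisRestrict_cast_eq {v w : HeightOneSpectrum (𝓞 K)} (e : v = w)
    (x : absoluteGaloisGroup (v.adicCompletion K)) :
    absGaloisRestrict K (w.adicCompletion K) (e ▸ x : absoluteGaloisGroup (w.adicCompletion K)) =
      absGaloisRestrict K (v.adicCompletion K) x := by
  subst e
  rfl

namespace ConjugationDatum

/-- **`cd.conj g · g ∈ Γ_{K[c]}`** for every `g ∈ Γ_K`: conjugation by the datum's complex conjugation `τ`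
inverts `Γ_K` modulo `Gal(K̄/K[c])` (§1 for the lift `cd.τ` of `cd.σ ≠ 1`).
[cite: Howard2004HeegnerKolyvagin, §1.3 (arXiv:1202.6340 p. 7 L33–41)] [cite: Cox2013, §9.A Lemma 9.3] -/
theorem conj_mul_mem_ringClassSubgroup (cd : ConjugationDatum K) (hK : IsImaginaryQuadratic K)
    (jbar : AlgebraicClosure K →+* ℂ) {c : ℕ} (hc : c ≠ 0) (g : absoluteGaloisGroup K) :
    cd.conj g * g ∈ ringClassSubgroup K c jbar :=
  cd.isLift.conjGalCMH_mul_mem_ringClassSubgroup cd.σ_ne_one hK jbar hc g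

/-- Cast-free form at any finite place `q`: for every `g ∈ Γ_{K_q}`, the product of the restrictions to `K̄` of
`φ_q g ∈ Γ_{K_{σ q}}` and of `g` lies in `Γ_{K[c]}`: `res (φ_q g) = δ_q⁻¹ (τ⁻¹ (res g) τ) δ_q` (`cd.compat`),
`τ⁻¹ r τ · r ∈ Γ_{K[c]}` (dihedral), `Γ_{K[c]}` normal with abelian quotient.
[cite: Howard2004HeegnerKolyvagin, §1.3 (arXiv p. 7 L44–48) with Lemma 1.5.3 (p. 10 L12–16)] [cite: Cox2013, §9.A Lemma 9.3] -/
theorem absGaloisRestrict_φ_mul_mem_ringClassSubgroup (cd : ConjugationDatum K) (hK : IsImaginaryQuadratic K)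
    (jbar : AlgebraicClosure K →+* ℂ) {c : ℕ} (hc : c ≠ 0) (q : HeightOneSpectrum (𝓞 K))
    (g : absoluteGaloisGroup (q.adicCompletion K)) :
    absGaloisRestrict K ((cd.σ • q).adicCompletion K) (cd.φ q g) *
        absGaloisRestrict K (q.adicCompletion K) g ∈ ringClassSubgroup K c jbar := by
  haveI := ringClassSubgroup_normal hK jbar hc
  rw [cd.compat]
  set r := absGaloisRestrict K (q.adicCompletion K) g
  have h1 : (cd.δ q)⁻¹ * (cd.conj r * r) * (cd.δ q)⁻¹⁻¹ ∈ ringClassSubgroup K c jbar :=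
    Subgroup.Normal.conj_mem inferInstance _ (cd.conj_mul_mem_ringClassSubgroup hK jbar hc r) (cd.δ q)⁻¹
  have h2 : (cd.δ q)⁻¹ * r⁻¹ * (cd.δ q)⁻¹⁻¹ * r⁻¹⁻¹ ∈ ringClassSubgroup K c jbar :=
    commutator_mem_ringClassSubgroup hK jbar hc (cd.δ q)⁻¹ r⁻¹
  have h3 : (cd.δ q)⁻¹ * cd.conj r * cd.δ q * r =
      ((cd.δ q)⁻¹ * (cd.conj r * r) * (cd.δ q)⁻¹⁻¹) * ((cd.δ q)⁻¹ * r⁻¹ * (cd.δ q)⁻¹⁻¹ * r⁻¹⁻¹) := by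
    group
  rw [h3]
  exact mul_mem h1 h2

/-- **The DIHEDRAL letter, for every conjugation datum**: at a finite place `q` fixed by `σ` (`h : cd.σ • q = q`,
e.g. a degree-two prime), for EVERY `g ∈ Γ_{K_q}`: `(h ▸ cd.φ q g) * g ∈ Λ_q = Γ_{K_q} ∩ Γ_{K[c]}`
(`localRingClassSubgroup c jbar q`) — the local transport inverts `Γ_{K_q}` modulo `Γ_{K_q} ∩ Γ_{K[c]}`, i.e. it
acts by inversion on `Gal(K[c]_q/K_q)`.  At `g := σ₀` this is VERBATIM the binder `hdih` of
`ResidualTau.transverse_eigen_decomposition_and_line` / `transverse_exists_eigenclass_ne_zero`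
(`InertEigenlinesProofs`). [cite: Howard2004HeegnerKolyvagin, Lemma 1.5.3 proof (arXiv p. 10 L12–16) with §1.3 (p. 7 L44–48)] [cite: Cox2013, §9.A Lemma 9.3] -/
theorem φ_cast_mul_mem_localRingClassSubgroup (cd : ConjugationDatum K) (hK : IsImaginaryQuadratic K)
    {q : HeightOneSpectrum (𝓞 K)} (h : cd.σ • q = q) (jbar : AlgebraicClosure K →+* ℂ) {c : ℕ}
    (hc : c ≠ 0) (g : absoluteGaloisGroup (q.adicCompletion K)) :
    (h ▸ cd.φ q g : absoluteGaloisGroup (q.adicCompletion K)) * g ∈ localRingClassSubgroup c jbar q := by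
  rw [localRingClassSubgroup, Subgroup.mem_comap, map_mul]
  change absGaloisRestrict K (q.adicCompletion K) (h ▸ cd.φ q g : absoluteGaloisGroup (q.adicCompletion K)) *
      absGaloisRestrict K (q.adicCompletion K) g ∈ ringClassSubgroup K c jbar
  rw [absGaloisRestrict_cast_eq h]
  exact cd.absGaloisRestrict_φ_mul_mem_ringClassSubgroup hK jbar hc q g

/-- **The letter `hφΛ`**: `∃ l ∈ Λ_q, (h ▸ cd.φ q g) = l * g⁻¹` for every `g ∈ Γ_{K_q}` — VERBATIM the binder
`hφΛ` of `InertLocalPairingSymmetricProofs`, `InertLagrangianTransferProofs`,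
`InertStubLocalizationTransferProofs`, `FrobeniusReadoutLagrangianTransferProofs` (x9-p1-w4), for EVERY
conjugation datum. [cite: Howard2004HeegnerKolyvagin, Lemma 1.5.3 proof (arXiv p. 10 L12–16) with §1.3 (p. 7 L44–48)] [cite: Cox2013, §9.A Lemma 9.3] -/
theorem exists_mem_localRingClassSubgroup_φ_cast_eq (cd : ConjugationDatum K) (hK : IsImaginaryQuadratic K)
    {q : HeightOneSpectrum (𝓞 K)} (h : cd.σ • q = q) (jbar : AlgebraicClosure K →+* ℂ) {c : ℕ}
    (hc : c ≠ 0) (g : absoluteGaloisGroup (q.adicCompletion K)) :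
    ∃ l ∈ localRingClassSubgroup c jbar q,
      (h ▸ cd.φ q g : absoluteGaloisGroup (q.adicCompletion K)) = l * g⁻¹ :=
  ⟨_, cd.φ_cast_mul_mem_localRingClassSubgroup hK h jbar hc g, by rw [mul_inv_cancel_right]⟩

/-- The same with the factors swapped: `g * (h ▸ cd.φ q g) ∈ Λ_q` (conjugate by `g`; `Λ_q` is normal in
`Γ_{K_q}` as the preimage of the normal `Γ_{K[c]}`). [cite: Howard2004HeegnerKolyvagin, Lemma 1.5.3 proof (arXiv p. 10 L12–16)] [cite: Cox2013, §9.A Lemma 9.3] -/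
theorem mul_φ_cast_mem_localRingClassSubgroup (cd : ConjugationDatum K) (hK : IsImaginaryQuadratic K)
    {q : HeightOneSpectrum (𝓞 K)} (h : cd.σ • q = q) (jbar : AlgebraicClosure K →+* ℂ) {c : ℕ}
    (hc : c ≠ 0) (g : absoluteGaloisGroup (q.adicCompletion K)) :
    g * (h ▸ cd.φ q g : absoluteGaloisGroup (q.adicCompletion K)) ∈ localRingClassSubgroup c jbar q := by
  haveI := ringClassSubgroup_normal hK jbar hc
  haveI : (localRingClassSubgroup c jbar q).Normal := by
    rw [localRingClassSubgroup]
    infer_instance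
  have h1 := Subgroup.Normal.conj_mem inferInstance _ (cd.φ_cast_mul_mem_localRingClassSubgroup hK h jbar hc g) g
  rwa [← mul_assoc, mul_inv_cancel_right] at h1

end ConjugationDatum

end Literature.NumberTheory.GaloisCohomology.Howard2004

end
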